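import Summits.CriticalPhenomena.PercolationContinuityZ3.Theorems.PercNearOneGluingNoHeavyLowerTailSahiT2E3
import Mathlib.Tactic.Linarith
import Mathlib.Tactic.Positivity
import Mathlib.Tactic.FieldSimp
import Mathlib.Tactic.Ring
import HarnessLib

/-!
# `NoHeavyLowerTail` (crux stmt-CriticalPhenomena-4575), P2 — **KAHN'S `C₃` FOR THE `(2,2)` CLASS `f(z₁,z₂,a), g(z₁,z₂,b), h(z₁,z₂,a,b)`**
# (the first class with two coordinates essential to all three functions)

Seat `prim-masterthm-p2`, gen 29 (memo `FROM-prim-masterthm-p2-g29-SQUARE-IDENTITY.md` §8–§9; `--supports stmt-CriticalPhenomena-4575`).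
No `sorry`, no named facts, standard axioms.

THEOREM (`sahiE_three_nonneg_T2`).  Let `α, β` be finite distributive lattices with FKG weights `wA, wB`, `w₁, w₂ ≥ 0` two-point laws
(`w_i 0 + w_i 1 = 1`), `f : Fin 2 → Fin 2 → α → ℝ`, `g : Fin 2 → Fin 2 → β → ℝ`, `h : Fin 2 → Fin 2 → α → β → ℝ` nonnegative and
monotone in every argument.  Then Sahi's third functional of the triple `(f(z₁,z₂,a), g(z₁,z₂,b), h(z₁,z₂,a,b))` under the product
weight `wA ⊗ wB ⊗ w₁ ⊗ w₂` is nonnegative — Kahn's correlation conjecture `C₃` / Sahi's `E₃ ≥ 0` for every triple of increasing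
functions in which the first two share exactly two coordinates, both of which the third one sees (`|T₃| = 2`, `C = ∅`).
PROOF.  The bicubic Bernstein expansion `sahiE_T2_eq` (`…SahiT2E3`) has sixteen coefficients, each a sum of nonnegative atoms:
point atoms (`patom_nonneg`: slice bound + Harris on `β`), edge atoms at either end (`edge_pieces`, `edge_piecesT`: one-dimensional
box identity with the rule `(0, 1−F_lo/F_hi)`), the three upper square corner atoms (`atoms_upper_nonneg`: the gen-29 square rule
with point-dependent `H`) and the joint coefficient `β₁₁` (`beta11_nonneg`).  This is the `(|γ|,|T|) = (2,2)` atom of the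
crossed-positivity programme (memo §8). [this work]
-/

noncomputable section

open scoped Classical

namespace Summit.CriticalPhenomena.PercolationContinuityZ3.Theorems

namespace SahiT2Square

open Finset Literature.Combinatorics.Sahi2008
open SahiHubTwoLevel (Fm gm Fm_nonneg)

section Edges

variable {α β : Type} [Fintype α] [Fintype β]
  (wA : α → ℝ) (wB : β → ℝ) (f : Fin 2 → Fin 2 → α → ℝ) (g : Fin 2 → Fin 2 → β → ℝ) (h : Fin 2 → Fin 2 → α → β → ℝ)

/-- Upper-edge fibre sum under `σ = (σ_lo, σ_hi)` (`lo = y`, `hi = T`). -/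
def edgeST (y₁ y₂ : Fin 2) (σlo σhi : ℝ) (b : β) : ℝ :=
  g 1 1 b * ((2 - σhi) * Ysl2 wA f h 1 1 b - Fm wA f y₁ y₂ * Hsl2 wA h 1 1 b - (1 - σlo) * Ysl2 wA f h y₁ y₂ b)
  + g y₁ y₂ b * ((2 - σlo) * Ysl2 wA f h y₁ y₂ b - Fm wA f 1 1 * Hsl2 wA h y₁ y₂ b - (1 - σhi) * Ysl2 wA f h 1 1 b)
/-- Upper-edge covariance part. -/
def edgeCPT (y₁ y₂ : Fin 2) (σlo σhi : ℝ) : ℝ :=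
  σhi * cov2 wA wB f g h 1 1 1 1 + (1 - σhi) * cov2 wA wB f g h y₁ y₂ 1 1
  + σlo * cov2 wA wB f g h y₁ y₂ y₁ y₂ + (1 - σlo) * cov2 wA wB f g h 1 1 y₁ y₂
/-- Upper-edge linear remainder. -/
def edgeRlinT (y₁ y₂ : Fin 2) (σlo σhi : ℝ) : ℝ :=
  σhi * (gm wB g 1 1 - gm wB g y₁ y₂) * Ybar2 wA wB f h 1 1 + σlo * (gm wB g y₁ y₂ - gm wB g 1 1) * Ybar2 wA wB f h y₁ y₂

end Edges

variable {α β : Type} [Fintype α] [Fintype β]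
  {wA : α → ℝ} {wB : β → ℝ} {f : Fin 2 → Fin 2 → α → ℝ} {g : Fin 2 → Fin 2 → β → ℝ} {h : Fin 2 → Fin 2 → α → β → ℝ}

/-- The one-dimensional box identity on an upper edge (every `σ`). -/
theorem edgeMainT_eq (y₁ y₂ : Fin 2) (σlo σhi : ℝ) :
    edgeMainT wA wB f g h y₁ y₂ = (∑ b, wB b * edgeST wA f g h y₁ y₂ σlo σhi b) + edgeCPT wA wB f g h y₁ y₂ σlo σhi
      + edgeRlinT wA wB f g h y₁ y₂ σlo σhi := by
  have e : ∀ b, wB b * edgeST wA f g h y₁ y₂ σlo σhi b =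
      (2 - σhi) * (wB b * (g 1 1 b * Ysl2 wA f h 1 1 b)) - Fm wA f y₁ y₂ * (wB b * (g 1 1 b * Hsl2 wA h 1 1 b))
        - (1 - σlo) * (wB b * (g 1 1 b * Ysl2 wA f h y₁ y₂ b))
      + ((2 - σlo) * (wB b * (g y₁ y₂ b * Ysl2 wA f h y₁ y₂ b)) - Fm wA f 1 1 * (wB b * (g y₁ y₂ b * Hsl2 wA h y₁ y₂ b))
        - (1 - σhi) * (wB b * (g y₁ y₂ b * Ysl2 wA f h 1 1 b))) := fun b => by unfold edgeST; ring
  have hs : (∑ b, wB b * edgeST wA f g h y₁ y₂ σlo σhi b) =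
      (2 - σhi) * M2 wA wB f g h 1 1 1 1 - Fm wA f y₁ y₂ * N2 wA wB g h 1 1 - (1 - σlo) * M2 wA wB f g h 1 1 y₁ y₂
      + ((2 - σlo) * M2 wA wB f g h y₁ y₂ y₁ y₂ - Fm wA f 1 1 * N2 wA wB g h y₁ y₂ - (1 - σhi) * M2 wA wB f g h y₁ y₂ 1 1) := by
    simp only [e, sum_add_distrib, sum_sub_distrib, ← mul_sum]; rfl
  rw [hs]; unfold edgeMainT edgeCPT cov2 edgeRlinT; ring

/-- Every point atom is nonnegative: `E_b[g_x(Y_x − F_xH_x)] + Cov_b(g_x,Y_x) ≥ 0`. -/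
theorem patom_nonneg [DistribLattice α] [DistribLattice β] (hA : IsFKGMeasure wA) (hB : IsFKGMeasure wB)
    (hf0 : ∀ z₁ z₂ a, 0 ≤ f z₁ z₂ a) (hfa : ∀ z₁ z₂, Monotone (f z₁ z₂))
    (hg0 : ∀ z₁ z₂ b, 0 ≤ g z₁ z₂ b) (hgb : ∀ z₁ z₂, Monotone (g z₁ z₂))
    (hh0 : ∀ z₁ z₂ a b, 0 ≤ h z₁ z₂ a b) (hha : ∀ z₁ z₂ b, Monotone (fun a => h z₁ z₂ a b)) (hhb : ∀ z₁ z₂ a, Monotone (h z₁ z₂ a))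
    (x₁ x₂ : Fin 2) : 0 ≤ patom wA wB f g h x₁ x₂ := by
  have hB0 := hB.nonneg
  have c := cov2_nonneg hB hA.nonneg hf0 hg0 hgb hh0 hhb x₁ x₂ x₁ x₂
  have s : 0 ≤ ∑ b, wB b * (g x₁ x₂ b * (Ysl2 wA f h x₁ x₂ b - Fm wA f x₁ x₂ * Hsl2 wA h x₁ x₂ b)) :=
    sum_nonneg fun b _ => mul_nonneg (hB0 b) (mul_nonneg (hg0 x₁ x₂ b)
      (sub_nonneg.2 (Fm_mul_Hsl2_le_Ysl2 hA hf0 hfa hh0 hha x₁ x₂ b)))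
  have e : patom wA wB f g h x₁ x₂ = (∑ b, wB b * (g x₁ x₂ b * (Ysl2 wA f h x₁ x₂ b - Fm wA f x₁ x₂ * Hsl2 wA h x₁ x₂ b)))
      + cov2 wA wB f g h x₁ x₂ x₁ x₂ := by
    have e1 : ∀ b, wB b * (g x₁ x₂ b * (Ysl2 wA f h x₁ x₂ b - Fm wA f x₁ x₂ * Hsl2 wA h x₁ x₂ b)) =
        wB b * (g x₁ x₂ b * Ysl2 wA f h x₁ x₂ b) - Fm wA f x₁ x₂ * (wB b * (g x₁ x₂ b * Hsl2 wA h x₁ x₂ b)) := fun b => by ring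
    simp only [e1, sum_sub_distrib, ← mul_sum]
    unfold patom cov2 M2 N2; ring
  rw [e]; exact add_nonneg s c

/-- Upper-edge analogue of `edge_pieces`: the edge atom at the lower corner dominates its remainder `Re ≥ κ(H̄_T − H̄_y)`. -/
theorem edge_piecesT [DistribLattice α] [DistribLattice β] (hA : IsFKGMeasure wA) (hB : IsFKGMeasure wB)
    (hf0 : ∀ z₁ z₂ a, 0 ≤ f z₁ z₂ a) (hfa : ∀ z₁ z₂, Monotone (f z₁ z₂))
    (hg0 : ∀ z₁ z₂ b, 0 ≤ g z₁ z₂ b) (hgb : ∀ z₁ z₂, Monotone (g z₁ z₂))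
    (hh0 : ∀ z₁ z₂ a b, 0 ≤ h z₁ z₂ a b) (hha : ∀ z₁ z₂ b, Monotone (fun a => h z₁ z₂ a b)) (hhb : ∀ z₁ z₂ a, Monotone (h z₁ z₂ a))
    {y₁ y₂ : Fin 2} (hfx : ∀ a, f y₁ y₂ a ≤ f 1 1 a) (hgx : ∀ b, g y₁ y₂ b ≤ g 1 1 b) (hhx : ∀ a b, h y₁ y₂ a b ≤ h 1 1 a b) :
    ∃ Re : ℝ, kap wA wB f g 1 1 y₁ y₂ * (Hb2 wA wB h 1 1 - Hb2 wA wB h y₁ y₂) ≤ Re ∧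
      Re ≤ edgeAtomT0 wA wB f g h y₁ y₂ := by
  have hA0 := hA.nonneg; have hB0 := hB.nonneg
  have f0 : 0 ≤ Fm wA f y₁ y₂ := Fm_nonneg hA0 hf0 y₁ y₂
  have flh : Fm wA f y₁ y₂ ≤ Fm wA f 1 1 := sum_le_sum fun a _ => mul_le_mul_of_nonneg_left (hfx a) (hA0 a)
  have glh : gm wB g y₁ y₂ ≤ gm wB g 1 1 := sum_le_sum fun b _ => mul_le_mul_of_nonneg_left (hgx b) (hB0 b)
  have sl := Fm_mul_Hsl2_le_Ysl2 (h := h) hA hf0 hfa hh0 hha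
  have mY : ∀ b, Ysl2 wA f h y₁ y₂ b ≤ Ysl2 wA f h 1 1 b := Ysl2_mono_pt hA0 hf0 hh0 hfx hhx
  have mH : ∀ b, Hsl2 wA h y₁ y₂ b ≤ Hsl2 wA h 1 1 b := Hsl2_mono_pt hA0 hhx
  have c := cov2_nonneg hB hA0 hf0 hg0 hgb hh0 hhb
  by_cases hz : Fm wA f 1 1 = 0
  · have h00 : Fm wA f y₁ y₂ = 0 := le_antisymm (by linarith) f0
    have hk : kap wA wB f g 1 1 y₁ y₂ = 0 := by unfold kap; rw [hz, h00]; ring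
    have hY : ∀ b, Ysl2 wA f h 1 1 b = 0 := fun b => Ysl2_eq_zero_of_Fm_eq_zero hA0 hf0 hz b
    have hY0 : ∀ b, Ysl2 wA f h y₁ y₂ b = 0 := fun b => Ysl2_eq_zero_of_Fm_eq_zero hA0 hf0 h00 b
    refine ⟨0, by rw [hk]; simp, ?_⟩
    unfold edgeAtomT0; rw [hk, edgeMainT_eq y₁ y₂ 0 0]
    have hS : ∀ b, edgeST wA f g h y₁ y₂ 0 0 b = 0 := fun b => by unfold edgeST; rw [hY, hY0, hz, h00]; ring
    have hCP : 0 ≤ edgeCPT wA wB f g h y₁ y₂ 0 0 := by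
      unfold edgeCPT
      have := c 1 1 1 1; have := c y₁ y₂ 1 1; have := c y₁ y₂ y₁ y₂; have := c 1 1 y₁ y₂
      nlinarith
    have hR : edgeRlinT wA wB f g h y₁ y₂ 0 0 = 0 := by unfold edgeRlinT; ring
    simp only [hS, mul_zero, sum_const_zero, hR]; linarith
  · have hpos : 0 < Fm wA f 1 1 := lt_of_le_of_ne (le_trans f0 flh) (Ne.symm hz)
    set σhi := 1 - Fm wA f y₁ y₂ / Fm wA f 1 1 with hσ
    have s0 : 0 ≤ σhi := by rw [hσ, sub_nonneg, div_le_one hpos]; exact flh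
    have s1 : σhi ≤ 1 := by have := div_nonneg f0 hpos.le; rw [hσ]; linarith
    refine ⟨edgeRlinT wA wB f g h y₁ y₂ 0 σhi - kap wA wB f g 1 1 y₁ y₂ * Hb2 wA wB h y₁ y₂, ?_, ?_⟩
    · have key := t2edgeR (Hb0 := Hb2 wA wB h y₁ y₂) hpos flh glh (Fm_mul_Hb2_le_Ybar2 hA hB0 hf0 hfa hh0 hha 1 1)
      have e : edgeRlinT wA wB f g h y₁ y₂ 0 σhi - kap wA wB f g 1 1 y₁ y₂ * Hb2 wA wB h y₁ y₂ =
          (1 - Fm wA f y₁ y₂ / Fm wA f 1 1) * (gm wB g 1 1 - gm wB g y₁ y₂) * Ybar2 wA wB f h 1 1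
            - (Fm wA f 1 1 - Fm wA f y₁ y₂) * (gm wB g 1 1 - gm wB g y₁ y₂) * Hb2 wA wB h y₁ y₂ := by
        unfold edgeRlinT kap; rw [hσ]; ring
      rw [e]; unfold kap; exact key
    · unfold edgeAtomT0; rw [edgeMainT_eq y₁ y₂ 0 σhi]
      have hS : ∀ b, 0 ≤ edgeST wA f g h y₁ y₂ 0 σhi b := fun b => by
        have Ehi := t2edge_hi (Ylo := Ysl2 wA f h y₁ y₂ b) hpos f0 (sl 1 1 b) (mY b)
        have Eboth := t2edge_both hpos flh (mH b) (sl y₁ y₂ b) (sl 1 1 b)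
        have e : edgeST wA f g h y₁ y₂ 0 σhi b = (g 1 1 b - g y₁ y₂ b) *
            ((2 - (1 - Fm wA f y₁ y₂ / Fm wA f 1 1)) * Ysl2 wA f h 1 1 b - Fm wA f y₁ y₂ * Hsl2 wA h 1 1 b
              - (1 - 0) * Ysl2 wA f h y₁ y₂ b)
            + g y₁ y₂ b * ((2 - (1 - Fm wA f y₁ y₂ / Fm wA f 1 1)) * Ysl2 wA f h 1 1 b - Fm wA f y₁ y₂ * Hsl2 wA h 1 1 b
              - (1 - 0) * Ysl2 wA f h y₁ y₂ b
              + ((2 - 0) * Ysl2 wA f h y₁ y₂ b - Fm wA f 1 1 * Hsl2 wA h y₁ y₂ b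
                - (1 - (1 - Fm wA f y₁ y₂ / Fm wA f 1 1)) * Ysl2 wA f h 1 1 b)) := by
          unfold edgeST; rw [hσ]; ring
        rw [e]
        exact add_nonneg (mul_nonneg (sub_nonneg.2 (hgx b)) Ehi) (mul_nonneg (hg0 y₁ y₂ b) Eboth)
      have hSum : 0 ≤ ∑ b, wB b * edgeST wA f g h y₁ y₂ 0 σhi b := sum_nonneg fun b _ => mul_nonneg (hB0 b) (hS b)
      have hCP : 0 ≤ edgeCPT wA wB f g h y₁ y₂ 0 σhi := by
        unfold edgeCPT
        have := c 1 1 1 1; have := c y₁ y₂ 1 1; have := c y₁ y₂ y₁ y₂; have := c 1 1 y₁ y₂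
        have := mul_nonneg s0 (c 1 1 1 1); have := mul_nonneg (sub_nonneg.2 s1) (c y₁ y₂ 1 1)
        nlinarith
      linarith

/-- **KAHN'S `C₃` FOR THE `(2,2)` CLASS.**  `E₃ ≥ 0` for `f(z₁,z₂,a), g(z₁,z₂,b), h(z₁,z₂,a,b)` under `wA ⊗ wB ⊗ w₁ ⊗ w₂`
(FKG blocks `α, β`; all three functions nonnegative and monotone in every argument). [this work] -/
theorem sahiE_three_nonneg_T2 [DistribLattice α] [DistribLattice β] (hA : IsFKGMeasure wA) (hB : IsFKGMeasure wB)
    {w1 w2 : Fin 2 → ℝ} (hw1 : ∀ z, 0 ≤ w1 z) (hw1s : w1 0 + w1 1 = 1) (hw2 : ∀ z, 0 ≤ w2 z) (hw2s : w2 0 + w2 1 = 1)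
    (hf0 : ∀ z₁ z₂ a, 0 ≤ f z₁ z₂ a) (hf1 : ∀ z₂ a, f 0 z₂ a ≤ f 1 z₂ a) (hf2 : ∀ z₁ a, f z₁ 0 a ≤ f z₁ 1 a)
    (hfa : ∀ z₁ z₂, Monotone (f z₁ z₂))
    (hg0 : ∀ z₁ z₂ b, 0 ≤ g z₁ z₂ b) (hg1 : ∀ z₂ b, g 0 z₂ b ≤ g 1 z₂ b) (hg2 : ∀ z₁ b, g z₁ 0 b ≤ g z₁ 1 b)
    (hgb : ∀ z₁ z₂, Monotone (g z₁ z₂))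
    (hh0 : ∀ z₁ z₂ a b, 0 ≤ h z₁ z₂ a b) (hh1 : ∀ z₂ a b, h 0 z₂ a b ≤ h 1 z₂ a b) (hh2 : ∀ z₁ a b, h z₁ 0 a b ≤ h z₁ 1 a b)
    (hha : ∀ z₁ z₂ b, Monotone (fun a => h z₁ z₂ a b)) (hhb : ∀ z₁ z₂ a, Monotone (h z₁ z₂ a)) :
    0 ≤ sahiE (fun q : α × β × (Fin 2 × Fin 2) => wA q.1 * wB q.2.1 * (w1 q.2.2.1 * w2 q.2.2.2)) 3
        ![fun q => f q.2.2.1 q.2.2.2 q.1, fun q => g q.2.2.1 q.2.2.2 q.2.1, fun q => h q.2.2.1 q.2.2.2 q.1 q.2.1] := by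
  have hA0 := hA.nonneg; have hB0 := hB.nonneg
  rw [sahiE_T2_eq hA.sum_eq_one hB.sum_eq_one hw1s hw2s]
  -- point atoms
  have P := patom_nonneg hA hB hf0 hfa hg0 hgb hh0 hha hhb
  -- lower edges {0,Z}, {0,C}
  obtain ⟨R1, hR1, hE1⟩ := edge_pieces (x₁ := 1) (x₂ := 0) hA hB hf0 hfa hg0 hgb hh0 hha hhb
    (fun a => hf1 0 a) (fun b => hg1 0 b) (fun a b => hh1 0 a b)
  obtain ⟨R2, hR2, hE2⟩ := edge_pieces (x₁ := 0) (x₂ := 1) hA hB hf0 hfa hg0 hgb hh0 hha hhb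
    (fun a => hf2 0 a) (fun b => hg2 0 b) (fun a b => hh2 0 a b)
  -- upper edges {Z,T}, {C,T}
  obtain ⟨R3, hR3, hE3⟩ := edge_piecesT (y₁ := 1) (y₂ := 0) hA hB hf0 hfa hg0 hgb hh0 hha hhb
    (fun a => hf2 1 a) (fun b => hg2 1 b) (fun a b => hh2 1 a b)
  obtain ⟨R4, hR4, hE4⟩ := edge_piecesT (y₁ := 0) (y₂ := 1) hA hB hf0 hfa hg0 hgb hh0 hha hhb
    (fun a => hf1 1 a) (fun b => hg1 1 b) (fun a b => hh1 1 a b)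
  -- the couplings κ ≥ 0 and the H̄ gaps ≥ 0
  have fmono : ∀ {x₁ x₂ y₁ y₂ : Fin 2}, (∀ a, f x₁ x₂ a ≤ f y₁ y₂ a) → Fm wA f x₁ x₂ ≤ Fm wA f y₁ y₂ :=
    fun hf => sum_le_sum fun a _ => mul_le_mul_of_nonneg_left (hf a) (hA0 a)
  have gmono : ∀ {x₁ x₂ y₁ y₂ : Fin 2}, (∀ b, g x₁ x₂ b ≤ g y₁ y₂ b) → gm wB g x₁ x₂ ≤ gm wB g y₁ y₂ :=
    fun hg => sum_le_sum fun b _ => mul_le_mul_of_nonneg_left (hg b) (hB0 b)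
  have kZ : 0 ≤ kap wA wB f g 1 0 0 0 := mul_nonneg (sub_nonneg.2 (fmono fun a => hf1 0 a)) (sub_nonneg.2 (gmono fun b => hg1 0 b))
  have kC : 0 ≤ kap wA wB f g 0 1 0 0 := mul_nonneg (sub_nonneg.2 (fmono fun a => hf2 0 a)) (sub_nonneg.2 (gmono fun b => hg2 0 b))
  have kTZ : 0 ≤ kap wA wB f g 1 1 1 0 := mul_nonneg (sub_nonneg.2 (fmono fun a => hf2 1 a)) (sub_nonneg.2 (gmono fun b => hg2 1 b))
  have kTC : 0 ≤ kap wA wB f g 1 1 0 1 := mul_nonneg (sub_nonneg.2 (fmono fun a => hf1 1 a)) (sub_nonneg.2 (gmono fun b => hg1 1 b))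
  have hZ0 : Hb2 wA wB h 0 0 ≤ Hb2 wA wB h 1 0 := Hb2_mono_pt hA0 hB0 (fun a b => hh1 0 a b)
  have hC0 : Hb2 wA wB h 0 0 ≤ Hb2 wA wB h 0 1 := Hb2_mono_pt hA0 hB0 (fun a b => hh2 0 a b)
  have hTZ : Hb2 wA wB h 1 0 ≤ Hb2 wA wB h 1 1 := Hb2_mono_pt hA0 hB0 (fun a b => hh2 1 a b)
  have hTC : Hb2 wA wB h 0 1 ≤ Hb2 wA wB h 1 1 := Hb2_mono_pt hA0 hB0 (fun a b => hh1 1 a b)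
  -- edge atoms at both ends are nonnegative
  have E10 : 0 ≤ edgeAtom wA wB f g h 1 0 := by nlinarith [mul_nonneg kZ (sub_nonneg.2 hZ0)]
  have E01 : 0 ≤ edgeAtom wA wB f g h 0 1 := by nlinarith [mul_nonneg kC (sub_nonneg.2 hC0)]
  have E10' : 0 ≤ edgeAtom1 wA wB f g h 1 0 := by
    have e : edgeAtom1 wA wB f g h 1 0 = edgeAtom wA wB f g h 1 0 - kap wA wB f g 1 0 0 0 * (Hb2 wA wB h 1 0 - Hb2 wA wB h 0 0) := by
      unfold edgeAtom1 edgeAtom; ring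
    rw [e]; linarith
  have E01' : 0 ≤ edgeAtom1 wA wB f g h 0 1 := by
    have e : edgeAtom1 wA wB f g h 0 1 = edgeAtom wA wB f g h 0 1 - kap wA wB f g 0 1 0 0 * (Hb2 wA wB h 0 1 - Hb2 wA wB h 0 0) := by
      unfold edgeAtom1 edgeAtom; ring
    rw [e]; linarith
  have ET10 : 0 ≤ edgeAtomT0 wA wB f g h 1 0 := by nlinarith [mul_nonneg kTZ (sub_nonneg.2 hTZ)]
  have ET01 : 0 ≤ edgeAtomT0 wA wB f g h 0 1 := by nlinarith [mul_nonneg kTC (sub_nonneg.2 hTC)]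
  have ET10' : 0 ≤ edgeAtomT1 wA wB f g h 1 0 := by
    have e : edgeAtomT1 wA wB f g h 1 0 = edgeAtomT0 wA wB f g h 1 0 - kap wA wB f g 1 1 1 0 * (Hb2 wA wB h 1 1 - Hb2 wA wB h 1 0) := by
      unfold edgeAtomT1 edgeAtomT0; ring
    rw [e]; linarith
  have ET01' : 0 ≤ edgeAtomT1 wA wB f g h 0 1 := by
    have e : edgeAtomT1 wA wB f g h 0 1 = edgeAtomT0 wA wB f g h 0 1 - kap wA wB f g 1 1 0 1 * (Hb2 wA wB h 1 1 - Hb2 wA wB h 0 1) := by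
      unfold edgeAtomT1 edgeAtomT0; ring
    rw [e]; linarith
  -- square atoms
  obtain ⟨A11, A10, A01⟩ := atoms_upper_nonneg hA hB hf0 hf1 hf2 hfa hg0 hg1 hg2 hgb hh0 hh1 hh2 hha hhb
  have B11 := beta11_nonneg hA hB hf0 hf1 hf2 hfa hg0 hg1 hg2 hgb hh0 hh1 hh2 hha hhb
  -- the sixteen coefficients
  have b01p : 0 ≤ b01 wA wB f g h := by unfold b01; linarith [P 0 0]
  have b02p : 0 ≤ b02 wA wB f g h := by unfold b02; linarith [P 0 1]
  have b10p : 0 ≤ b10 wA wB f g h := by unfold b10; linarith [P 0 0]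
  have b20p : 0 ≤ b20 wA wB f g h := by unfold b20; linarith [P 1 0]
  have b31p : 0 ≤ b31 wA wB f g h := by unfold b31; linarith [P 1 0]
  have b32p : 0 ≤ b32 wA wB f g h := by unfold b32; linarith [P 1 1]
  have b13p : 0 ≤ b13 wA wB f g h := by unfold b13; linarith [P 0 1]
  have b23p : 0 ≤ b23 wA wB f g h := by unfold b23; linarith [P 1 1]
  have b12p : 0 ≤ b12 wA wB f g h := by unfold b12; linarith [P 0 1]
  have b21p : 0 ≤ b21 wA wB f g h := by unfold b21; linarith [P 1 0]
  have b22p : 0 ≤ b22 wA wB f g h := by unfold b22; linarith [P 1 1]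
  unfold bernsteinSum
  have row : ∀ {c x1 x2 x3 x4 : ℝ}, 0 ≤ c → 0 ≤ x1 → 0 ≤ x2 → 0 ≤ x3 → 0 ≤ x4 → 0 ≤ c * (x1 + x2 + x3 + x4) :=
    fun hc h1 h2 h3 h4 => mul_nonneg hc (add_nonneg (add_nonneg (add_nonneg h1 h2) h3) h4)
  have u0 := hw1 0; have u1 := hw1 1; have v0 := hw2 0; have v1 := hw2 1
  have m30 : 0 ≤ w2 0 ^ 3 := pow_nonneg v0 3
  have m21 : 0 ≤ w2 0 ^ 2 * w2 1 := mul_nonneg (pow_nonneg v0 2) v1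
  have m12 : 0 ≤ w2 0 * w2 1 ^ 2 := mul_nonneg v0 (pow_nonneg v1 2)
  have m03 : 0 ≤ w2 1 ^ 3 := pow_nonneg v1 3
  exact add_nonneg (add_nonneg (add_nonneg
    (row (pow_nonneg u0 3) (mul_nonneg m30 (P 0 0)) (mul_nonneg m21 b01p) (mul_nonneg m12 b02p) (mul_nonneg m03 (P 0 1)))
    (row (mul_nonneg (pow_nonneg u0 2) u1) (mul_nonneg m30 b10p) (mul_nonneg m21 B11) (mul_nonneg m12 b12p) (mul_nonneg m03 b13p)))
    (row (mul_nonneg u0 (pow_nonneg u1 2)) (mul_nonneg m30 b20p) (mul_nonneg m21 b21p) (mul_nonneg m12 b22p) (mul_nonneg m03 b23p)))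
    (row (pow_nonneg u1 3) (mul_nonneg m30 (P 1 0)) (mul_nonneg m21 b31p) (mul_nonneg m12 b32p) (mul_nonneg m03 (P 1 1)))

end SahiT2Square

end Summit.CriticalPhenomena.PercolationContinuityZ3.Theorems
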